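import Summits.QuantumFields.BalabanUV.Beta.GAN24.SymLinKernelBlockMoments

/-!
# `BalabanUV.Beta.GAN24.SymLinKernelFaceSupport` — binder row G-an2-4 ∕ (CONV-C), CT-W route «WC-TL» ∕ (Q-R) «QR-LL», the (S) row of RULING R-gan24p1-g27-1,
# piece (S-β), PART 3a: **an1's SYMMETRISED FIRST-ORDER KERNEL ON EXIT-FACE BONDS** — the AXIAL block reflection of one coarse bond's kernel (along its own
# direction, through the midpoint of its two blocks), the vanishing of the kernel on every exit-face bond except the straight piece's crossing of the MIDDLE face,
# the exit-face indicator as the exterior derivative of the COARSE coordinate, and the pointwise vanishing of «exit-face indicator × coarse-coordinate weight ×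
# kernel» that kills the (β)-letter charge in the TRANSPORTED (exit-face) currency of p2's `SandwichReadoutSiteDep.hasSum_sandwich_readout_coDressKBmAt`
# (G-an2-4 formalisation swarm → CRUX TEAM (2), seat `b2b-balaban-gan24-formalise-leaf-02`, gen 55)

NOT IN PRINT; OUR BOOKKEEPING ([folklore] integer arithmetic + an1's GLOBAL reflection law `SymRootedKernelReflectionCore.symLinCountAt_fref` (every axis, centred root,
`L` odd) composed with block covariance `symLinCountAt_add`, exactly as PART 1b did for the transverse axes; PART 1a's transverse support; 0 `def`, 0 cited fact,
0 `def … : Prop`, 0 sorry).  HONEST FRAMING (cell contract, verbatim): «discharging `BetaPertH` makes Bałaban's UV stability UNCONDITIONAL — a real constructive-QFT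
result; it is NOT the continuum limit and NOT the Clay problem.»  HONEST DEPENDENCY (verbatim): «continuum YM on T⁴ ⇐ BetaPertH ∧ nine spine estimates (0/9 proved);
BetaPertH ⇐ (D1) ∧ (D4) ∧ CAP+tail; G-an2-4 gates asym, D1 and NE2/3/4.»

WHY.  The next S-step reads the level-`j` first-order data through the sandwich `G ∘ (·) ∘ G`; p2 g35's read-out shows that ONLY the EXIT-FACE two-leg charges
`Z^{face}_{ab}(V) = Σ'_{(x,z)} 𝟙[x_a % L = L−1]·V x z (inl a) (inl b)·𝟙[z_b % L = L−1]` of a letter survive.  The exit-face indicator is EXACT —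
`𝟙[κ = a]·𝟙[x_a % L = L−1] = (dz ⌊·_a ∕ L⌋)(κ, x)` — so the `dψ`-laws of `GAN24.SymHessianGaugeLegContact` apply with `ψ` = a COARSE coordinate, and the (β)-letter's face charge
reduces to first-order sums `Σ_x F(x)·𝟙[x_β % L = L−1]·(ψ(x) + ψ(x+e_β) − ψ(r) − ψ(r + L•e_μ))·q¹(β,x)`; this file proves the integrand is IDENTICALLY ZERO.
* §1 `int_ediv_add_one`, **`exitFace_eq_dz_blk`** (`𝟙[x_a % L = L−1] = dz (z ↦ ⌊z_a∕L⌋) a x`, and `dz (…) κ x = 0` for `κ ≠ a`).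
* §2 `bref_sub_blockShift_self`, **`symLinCountAt_axialRefl`** ∕ `symLinKerAt_axialRefl` (`L` odd, centred root): `q(κ, x⋆) = −ε_κ·q(κ,x)`,
  `x⋆ = sref μ x + (L(2y_μ+2) − [κ=μ])•e_μ` — the reflection of the bond's own axis through the midpoint of its two blocks.
* §3 **`symLinKerAt_eq_zero_of_exitFace_of_ne`** (`β ≠ μ`: the kernel vanishes on every exit-face bond of direction `β`), **`symLinKerAt_eq_zero_of_topFace`**
  (direction `μ`: it vanishes on the far block's exit face `x_μ = L·y_μ + 2L − 1`), `exitFace_support_mu` (direction `μ`, nonzero kernel, exit face ⇒ `x_μ = L·y_μ + L − 1`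
  and every transverse coordinate in the block range).
* §4 **`exitFace_coarseWeight_mul_symLinKerAt_eq_zero`**: for EVERY `β λ x`, `𝟙[x_β % L = L−1]·(⌊x_λ∕L⌋ + ⌊(x+e_β)_λ∕L⌋ − ⌊r_λ∕L⌋ − ⌊(r+L•e_μ)_λ∕L⌋)·q¹(β,x) = 0`.
Discharges NOTHING of (S) ∕ (Q-R) ∕ (LT) ∕ (Q-L) ∕ (C) ∕ «T2Shape» ∕ «T2Drift» ∕ (hW, hWall) by itself; NEVER «G-an2-4 closed» as (CONV-C); NOT D1, NOT `BetaPertH`, NOT continuum,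
NOT Clay.  2026-08-22; no existing file touched.
-/

noncomputable section

open Finset
open scoped BigOperators Nat
open Literature.MathematicalPhysics.QuantumFieldTheory.Balaban1983to89.Beta
open AffineAveraging (Form1 Site unitVec unitVec_apply box toSite dz)
open AveragingContours (blk)
open AveragingContoursRooted (ctr ctrOff ctr_apply ctrOff_mem_box two_mul_half_add_one)
open AveragingHessianKernels (Bond Near)
open ResolventReflection (sref sref_apply bref bref_apply)
open RootedKernelReflection (fref zsgn zsgn_self zsgn_of_ne zsgn_mul_self cast_zsgn)
open Summit.QuantumFields.BalabanUV.Beta.SymAveragingHessianCounts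
open Summit.QuantumFields.BalabanUV.Beta.SymRootedKernelReflection (symLinCountAt_fref)
open Summit.QuantumFields.BalabanUV.Beta.LinearGaugeVH (nearBox mem_nearBox)
open Summit.QuantumFields.BalabanUV.Beta.GAN24.SymLinKernelExpansion (symLinKerAt_eq_zero_of_transverse symLinKerAt_eq_zero_of_not_mem)
open Summit.QuantumFields.BalabanUV.Beta.GAN24.SymLinKernelBlockMoments (symLinKerAt_blockRefl ediv_eq_of_mem_range)

namespace Summit.QuantumFields.BalabanUV.Beta.GAN24.SymLinKernelFaceSupport

variable {d : ℕ}

/-! ## §1 The exit-face indicator is the exterior derivative of the coarse coordinate -/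

/-- [folklore] `(a + 1) / L = a / L + [a % L = L − 1]` over `ℤ` (`1 ≤ L`). -/
theorem int_ediv_add_one {L : ℕ} (hL : 1 ≤ L) (a : ℤ) :
    (a + 1) / (L : ℤ) = a / (L : ℤ) + (if a % (L : ℤ) = (L : ℤ) - 1 then 1 else 0) := by
  have hL0 : (0 : ℤ) < L := by exact_mod_cast hL
  have hdiv := Int.emod_add_mul_ediv a (L : ℤ)   -- a % L + L * (a / L) = a
  have hm0 := Int.emod_nonneg a (ne_of_gt hL0)
  have hmL := Int.emod_lt_of_pos a hL0
  set q := a / (L : ℤ) with hq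
  set m := a % (L : ℤ) with hm
  split_ifs with h
  · -- a + 1 = L * (q + 1)
    have e : a + 1 = (0 : ℤ) + (L : ℤ) * (q + 1) := by rw [← hdiv, h]; ring
    rw [e, Int.add_mul_ediv_left _ _ (ne_of_gt hL0), Int.ediv_eq_zero_of_lt (le_refl _) hL0, zero_add]
  · have e : a + 1 = (m + 1) + (L : ℤ) * q := by rw [← hdiv]; ring
    rw [e, Int.add_mul_ediv_left _ _ (ne_of_gt hL0), Int.ediv_eq_zero_of_lt (by omega) (by omega), zero_add, add_zero]

/-- [folklore] **THE EXIT-FACE INDICATOR IS EXACT**: `𝟙[x_a % L = L−1] = dz (z ↦ ⌊z_a ∕ L⌋) a x` — the exterior derivative of the `a`-th COARSE coordinate, read on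
the `a`-bonds; on the other bonds that derivative vanishes (`exitFace_dz_blk_of_ne`). -/
theorem exitFace_eq_dz_blk {L : ℕ} (hL : 1 ≤ L) (a : Fin (d + 1)) (x : Fin (d + 1) → ℤ) :
    (if x a % (L : ℤ) = (L : ℤ) - 1 then (1 : ℝ) else 0) = dz (fun z : Fin (d + 1) → ℤ => ((z a / (L : ℤ) : ℤ) : ℝ)) a x := by
  simp only [AffineAveraging.dz, Pi.add_apply, unitVec_apply, if_true]
  rw [int_ediv_add_one hL]
  push_cast
  split_ifs <;> ring

/-- [folklore] … and `dz (z ↦ ⌊z_a ∕ L⌋) κ x = 0` for `κ ≠ a`. -/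
theorem dz_blk_of_ne {L : ℕ} (a : Fin (d + 1)) {κ : Fin (d + 1)} (hκ : κ ≠ a) (x : Fin (d + 1) → ℤ) :
    dz (fun z : Fin (d + 1) → ℤ => ((z a / (L : ℤ) : ℤ) : ℝ)) κ x = 0 := by
  simp only [AffineAveraging.dz, Pi.add_apply, unitVec_apply, if_neg (Ne.symm hκ), add_zero, sub_self]

/-! ## §2 The axial block reflection of ONE coarse bond's kernel (along its own direction; centred root, `L` odd) -/

/-- [folklore] The reflected base point along the bond's own axis: `bref μ κ (x − L•(y − bref μ μ y)) = sref μ x + (L(2y_μ+2) − [κ=μ])•e_μ` (`bref μ μ y = sref μ y − e_μ`). -/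
theorem bref_sub_blockShift_self (L : ℕ) (y : Fin (d + 1) → ℤ) (μ κ : Fin (d + 1)) (x : Fin (d + 1) → ℤ) :
    bref μ κ (x - (L : ℤ) • (y - bref μ μ y))
      = sref μ x + ((L : ℤ) * (2 * y μ + 2) - (if κ = μ then 1 else 0)) • unitVec μ := by
  funext i
  simp only [bref_apply, sref_apply, Pi.sub_apply, Pi.add_apply, Pi.smul_apply, smul_eq_mul, unitVec_apply, if_true]
  by_cases hi : i = μ
  · subst hi
    simp only [if_true]
    split_ifs <;> ring
  · simp only [if_neg hi, mul_zero, add_zero]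
    ring

/-- NOT IN PRINT; OUR BOOKKEEPING.  **THE AXIAL BLOCK REFLECTION OF ONE BOND'S SYMMETRISED LINEAR COUNT** (centred root, `L` odd): along the bond's own direction `μ`,
`LIN_sym,(μ,y)(κ, x⋆) = −ε_κ · LIN_sym,(μ,y)(κ, x)` with `x⋆ := sref μ x + (L(2y_μ+2) − [κ=μ])•e_μ`, the reflection of axis `μ` through the midpoint of the TWO blocks
`B(y) ∪ B(y+e_μ)` the pair words live in (the coarse bond is reversed, hence the extra sign `ε_μ = −1`).  an1's `symLinCountAt_fref` at `α = μ` ∘ `symLinCountAt_add`. -/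
theorem symLinCountAt_axialRefl {L : ℕ} (hL : Odd L) (μ : Fin (d + 1)) (y : Fin (d + 1) → ℤ) (κ : Fin (d + 1)) (x : Fin (d + 1) → ℤ) :
    symLinCountAt (ctr (d + 1) L) L μ y (κ, sref μ x + ((L : ℤ) * (2 * y μ + 2) - (if κ = μ then 1 else 0)) • unitVec μ)
      = -(zsgn μ κ * symLinCountAt (ctr (d + 1) L) L μ y (κ, x)) := by
  set v : Fin (d + 1) → ℤ := (L : ℤ) • (y - bref μ μ y) with hv
  have h1 := symLinCountAt_fref hL μ μ y (κ, x - v)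
  have h2 := symLinCountAt_add (ctr (d + 1) L) L μ (bref μ μ y) (y - bref μ μ y) (κ, x - v)
  have e1 : bref μ μ y + (y - bref μ μ y) = y := by abel
  have e2 : AveragingHessianKernels.Bond.sh ((κ, x - v) : Bond (d + 1)) ((L : ℤ) • (y - bref μ μ y)) = (κ, x) := by
    show (κ, x - v + (L : ℤ) • (y - bref μ μ y)) = (κ, x)
    rw [hv, sub_add_cancel]
  rw [e1, e2] at h2
  have e3 : fref μ ((κ, x - v) : Bond (d + 1)) = (κ, sref μ x + ((L : ℤ) * (2 * y μ + 2) - (if κ = μ then 1 else 0)) • unitVec μ) := by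
    show (κ, bref μ κ (x - v)) = _
    rw [hv, bref_sub_blockShift_self]
  rw [e3, zsgn_self, ← h2] at h1
  rw [h1]
  simp only [mul_neg, neg_mul, mul_one]

/-- [folklore] The same for the real kernel `q¹_sym`. -/
theorem symLinKerAt_axialRefl {L : ℕ} (hL : Odd L) (μ : Fin (d + 1)) (y : Fin (d + 1) → ℤ) (κ : Fin (d + 1)) (x : Fin (d + 1) → ℤ) :
    symLinKerAt (ctr (d + 1) L) L μ y (κ, sref μ x + ((L : ℤ) * (2 * y μ + 2) - (if κ = μ then 1 else 0)) • unitVec μ)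
      = -((zsgn μ κ : ℝ) * symLinKerAt (ctr (d + 1) L) L μ y (κ, x)) := by
  rw [symLinKerAt, symLinKerAt, symLinCountAt_axialRefl hL, Int.cast_neg, Int.cast_mul, neg_div, mul_div_assoc]

/-! ## §3 The kernel on exit-face bonds -/

/-- NOT IN PRINT; OUR BOOKKEEPING.  **A TRANSVERSE DIRECTION CARRIES NO KERNEL ON EXIT-FACE BONDS** (centred root, `L` odd, `β ≠ μ`): if `x_β % L = L − 1` then
`q¹_sym,(μ,y)(β, x) = 0` — off the block row it is PART 1a's transverse support; ON the block's own exit face the transverse block reflection of PART 1b (axis `β`,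
`κ = β`) maps the bond to one based at `L·y_β − 1`, outside the support, with the same kernel up to sign. -/
theorem symLinKerAt_eq_zero_of_exitFace_of_ne {L : ℕ} (hL : Odd L) {β μ : Fin (d + 1)} (hβ : β ≠ μ) (y : Fin (d + 1) → ℤ) {x : Fin (d + 1) → ℤ}
    (hx : x β % (L : ℤ) = (L : ℤ) - 1) : symLinKerAt (ctr (d + 1) L) L μ y (β, x) = 0 := by
  have hL1 : 1 ≤ L := by obtain ⟨m, rfl⟩ := hL; omega
  have hL0 : (0 : ℤ) < L := by exact_mod_cast hL1
  have hr := ctrOff_mem_box (d := d + 1) hL1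
  by_cases hrange : (L : ℤ) * y β ≤ x β ∧ x β ≤ (L : ℤ) * y β + (L - 1)
  · -- on the block row: `x_β = L·y_β + L − 1`; reflect the axis `β`
    have hxβ : x β = (L : ℤ) * y β + (L - 1) := by
      have hq : x β / (L : ℤ) = y β := ediv_eq_of_mem_range hL1 hrange
      have hdm := Int.emod_add_mul_ediv (x β) (L : ℤ)
      rw [hq, hx] at hdm
      linarith
    have href := symLinKerAt_blockRefl hL hβ y β x
    rw [if_pos rfl, zsgn_self, Int.cast_neg, Int.cast_one, neg_one_mul] at href
    -- the mirror bond is based at `L·y_β − 1`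
    have hout : ¬ ((L : ℤ) * y β ≤ (sref β x + ((L : ℤ) * (2 * y β + 1) - 1) • unitVec β) β
        ∧ (sref β x + ((L : ℤ) * (2 * y β + 1) - 1) • unitVec β) β ≤ (L : ℤ) * y β + (L - 1)) := by
      simp only [Pi.add_apply, Pi.smul_apply, smul_eq_mul, sref_apply, unitVec_apply, if_true, mul_one]
      rw [hxβ]
      intro h
      nlinarith [h.1]
    have h0 : symLinKerAt (ctr (d + 1) L) L μ y (β, sref β x + ((L : ℤ) * (2 * y β + 1) - 1) • unitVec β) = 0 :=
      symLinKerAt_eq_zero_of_transverse hr hβ hout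
    rw [h0] at href
    linarith
  · exact symLinKerAt_eq_zero_of_transverse hr hβ hrange

/-- NOT IN PRINT; OUR BOOKKEEPING.  **THE KERNEL VANISHES ON THE FAR BLOCK'S EXIT FACE IN ITS OWN DIRECTION** (centred root, `L` odd): if `x_μ = L·y_μ + 2L − 1` then
`q¹_sym,(μ,y)(μ, x) = 0` — the axial reflection of §2 maps this bond to one based at `L·y_μ − 1`, outside node 7a's support box `Near`. -/
theorem symLinKerAt_eq_zero_of_topFace {L : ℕ} (hL : Odd L) (μ : Fin (d + 1)) (y : Fin (d + 1) → ℤ) {x : Fin (d + 1) → ℤ}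
    (hx : x μ = (L : ℤ) * y μ + (2 * L - 1)) : symLinKerAt (ctr (d + 1) L) L μ y (μ, x) = 0 := by
  have hL1 : 1 ≤ L := by obtain ⟨m, rfl⟩ := hL; omega
  have hr := ctrOff_mem_box (d := d + 1) hL1
  have href := symLinKerAt_axialRefl hL μ y μ x
  rw [if_pos rfl, zsgn_self, Int.cast_neg, Int.cast_one, neg_one_mul, neg_neg] at href
  have hout : (sref μ x + ((L : ℤ) * (2 * y μ + 2) - 1) • unitVec μ) ∉ nearBox L y := by
    intro hm
    have hN := (mem_nearBox.1 hm) μ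
    simp only [Pi.add_apply, Pi.smul_apply, smul_eq_mul, sref_apply, unitVec_apply, if_true, mul_one, hx] at hN
    nlinarith [hN.1]
  have h0 : symLinKerAt (ctr (d + 1) L) L μ y (μ, sref μ x + ((L : ℤ) * (2 * y μ + 2) - 1) • unitVec μ) = 0 :=
    symLinKerAt_eq_zero_of_not_mem hr μ hout μ
  rw [h0] at href
  linarith

/-- NOT IN PRINT; OUR BOOKKEEPING.  **WHERE THE KERNEL MEETS AN EXIT FACE IN ITS OWN DIRECTION** (centred root, `L` odd): if `q¹_sym,(μ,y)(μ, x) ≠ 0` and `x_μ % L = L − 1`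
then `x_μ = L·y_μ + L − 1` (the MIDDLE face, crossed by the straight piece) and every transverse coordinate lies in the block range `[L·y_i, L·y_i + L − 1]`. -/
theorem exitFace_support_mu {L : ℕ} (hL : Odd L) (μ : Fin (d + 1)) (y : Fin (d + 1) → ℤ) {x : Fin (d + 1) → ℤ}
    (hq : symLinKerAt (ctr (d + 1) L) L μ y (μ, x) ≠ 0) (hx : x μ % (L : ℤ) = (L : ℤ) - 1) :
    x μ = (L : ℤ) * y μ + (L - 1) ∧ ∀ i, i ≠ μ → (L : ℤ) * y i ≤ x i ∧ x i ≤ (L : ℤ) * y i + (L - 1) := by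
  have hL1 : 1 ≤ L := by obtain ⟨m, rfl⟩ := hL; omega
  have hL0 : (0 : ℤ) < L := by exact_mod_cast hL1
  have hr := ctrOff_mem_box (d := d + 1) hL1
  refine ⟨?_, fun i hi => ?_⟩
  · -- `x ∈ Near`: `L y_μ ≤ x_μ ≤ L y_μ + 2L − 1`; with `x_μ % L = L−1` this leaves the middle and the top face; the top face is excluded by §3
    have hmem : x ∈ nearBox L y := by
      by_contra h; exact hq (symLinKerAt_eq_zero_of_not_mem hr μ h μ)
    have hN := (mem_nearBox.1 hmem) μ
    have hdm := Int.emod_add_mul_ediv (x μ) (L : ℤ)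
    rw [hx] at hdm
    -- `x_μ = L·q + L − 1` with `q ∈ {y_μ, y_μ + 1}`
    set q := x μ / (L : ℤ) with hqd
    have hq1 : y μ ≤ q := by nlinarith [hN.1]
    have hq2 : q ≤ y μ + 1 := by nlinarith [hN.2]
    rcases lt_or_eq_of_le hq2 with hlt | heq
    · have : q = y μ := le_antisymm (by omega) hq1
      rw [this] at hdm; linarith
    · exfalso
      rw [heq] at hdm
      exact hq (symLinKerAt_eq_zero_of_topFace hL μ y (by linarith))
  · by_contra h
    exact hq (symLinKerAt_eq_zero_of_transverse hr hi h)

/-! ## §4 The pointwise vanishing of «exit-face indicator × coarse-coordinate weight × kernel» -/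

/-- NOT IN PRINT; OUR BOOKKEEPING.  **THE EXIT-FACE ∕ COARSE-COORDINATE INTEGRAND VANISHES POINTWISE** (centred root, `L` odd; EVERY `β λ x`):
`𝟙[x_β % L = L−1] · (⌊x_λ∕L⌋ + ⌊(x+e_β)_λ∕L⌋ − ⌊r_λ∕L⌋ − ⌊(r + L•e_μ)_λ∕L⌋) · q¹_sym,(μ,y)(β, x) = 0`, `r = L•y + ρ_c` — for `β ≠ μ` the kernel vanishes on exit faces (§3),
for `β = μ` the bond crosses the MIDDLE face and the coarse coordinates of its two endpoints reproduce those of the two roots (`y_λ + [λ=μ]`), so the weight is `0`. -/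
theorem exitFace_coarseWeight_mul_symLinKerAt_eq_zero {L : ℕ} (hL : Odd L) (μ : Fin (d + 1)) (y : Fin (d + 1) → ℤ) (β lam : Fin (d + 1))
    (x : Fin (d + 1) → ℤ) :
    (if x β % (L : ℤ) = (L : ℤ) - 1 then (1 : ℝ) else 0)
      * ((((x lam / (L : ℤ) : ℤ)) : ℝ) + ((((x + unitVec β) lam / (L : ℤ) : ℤ)) : ℝ)
          - (((((L : ℤ) • y + ctr (d + 1) L) lam / (L : ℤ) : ℤ)) : ℝ) - (((((L : ℤ) • y + ctr (d + 1) L + (L : ℤ) • unitVec μ) lam / (L : ℤ) : ℤ)) : ℝ))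
      * symLinKerAt (ctr (d + 1) L) L μ y (β, x) = 0 := by
  have hL1 : 1 ≤ L := by obtain ⟨m, rfl⟩ := hL; omega
  have hL0 : (0 : ℤ) < L := by exact_mod_cast hL1
  have hr := ctrOff_mem_box (d := d + 1) hL1
  have hc : ∀ i, 0 ≤ ctr (d + 1) L i ∧ ctr (d + 1) L i ≤ (L : ℤ) - 1 := by
    intro i; rw [ctr_apply]; have := two_mul_half_add_one hL; constructor <;> omega
  -- the coarse coordinates of the two roots
  have hroot : ∀ i, ((L : ℤ) • y + ctr (d + 1) L) i / (L : ℤ) = y i := by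
    intro i
    exact ediv_eq_of_mem_range hL1 (by simp only [Pi.add_apply, Pi.smul_apply, smul_eq_mul]; constructor <;> nlinarith [(hc i).1, (hc i).2])
  have hroot' : ∀ i, ((L : ℤ) • y + ctr (d + 1) L + (L : ℤ) • unitVec μ) i / (L : ℤ) = y i + (if i = μ then 1 else 0) := by
    intro i
    refine ediv_eq_of_mem_range hL1 ?_
    simp only [Pi.add_apply, Pi.smul_apply, smul_eq_mul, unitVec_apply]
    split_ifs <;> constructor <;> nlinarith [(hc i).1, (hc i).2]
  by_cases hx : x β % (L : ℤ) = (L : ℤ) - 1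
  · rw [if_pos hx, one_mul]
    by_cases hβ : β = μ
    · subst hβ
      by_cases hq : symLinKerAt (ctr (d + 1) L) L β y (β, x) = 0
      · rw [hq, mul_zero]
      · -- the middle face: the coarse coordinates of the endpoints are those of the roots
        obtain ⟨hxβ, htr⟩ := exitFace_support_mu hL β y hq hx
        have hlam : x lam / (L : ℤ) = y lam := by
          by_cases hl : lam = β
          · subst hl; exact ediv_eq_of_mem_range hL1 ⟨by linarith, by linarith⟩
          · exact ediv_eq_of_mem_range hL1 (htr lam hl)
        have hlam' : (x + unitVec β) lam / (L : ℤ) = y lam + (if lam = β then 1 else 0) := by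
          refine ediv_eq_of_mem_range hL1 ?_
          simp only [Pi.add_apply, unitVec_apply]
          by_cases hl : lam = β
          · subst hl; rw [if_pos rfl]; constructor <;> linarith
          · rw [if_neg hl]; have := htr lam hl; constructor <;> linarith
        rw [hlam, hlam', hroot, hroot']
        push_cast
        ring
    · rw [symLinKerAt_eq_zero_of_exitFace_of_ne hL hβ y hx, mul_zero]
  · rw [if_neg hx, zero_mul, zero_mul]

end Summit.QuantumFields.BalabanUV.Beta.GAN24.SymLinKernelFaceSupport

end
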